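import Literature.Geometry.GeometricMeasureTheory.CurrentsConstancy
import Literature.Geometry.GeometricMeasureTheory.CurrentsSlicing
import Literature.Geometry.GeometricMeasureTheory.CurrentsDilation
import Literature.Geometry.GeometricMeasureTheory.FrameVectorDet
import Mathlib.Analysis.InnerProductSpace.Dual
import Mathlib.Analysis.Distribution.AEEqOfIntegralContDiff
import Mathlib.MeasureTheory.Measure.Decomposition.RadonNikodym
import HarnessLib

/-!
# White's constant vectorfield lemma

Support file for the proof of the named fact
`Literature.Geometry.GeometricMeasureTheory.Federer1969_compactness_integralCurrents` along
B. White's structure-theorem-free proof of the closure theorem [White1989]; the step "the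
constant vectorfield lemma" [White1989, p. 213; Bandara2006, Thm. 3.3.6, Lemma 4.1.9]: if `ν` is a
Radon measure on `ℝⁿ⁺ᵏ`, `τ` a constant `n`-vector and the current `ν ∧ τ` is a cycle, then `ν` is
invariant under the translations of an explicit linear subspace `W_τ` and `τ ∈ ⋀ₙ W_τ`, so that
`τ = 0` if `dim W_τ < n` and `τ` is simple if `dim W_τ = n`.

## Contents

* Frame calculus for `m`-covectors / `m`-vectors of a real inner product space (Federer 1.7.5):
  `frameCovector_comp_perm` (permuting a frame multiplies its dual covector by the sign),
  `wedgeOne_innerSL_frameCovector` (`u^♭ ∧ (f₁^♭ ∧ ⋯ ∧ f_k^♭) = (u, f₁, …, f_k)^♭`, the Laplace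
  expansion), **`sum_frameCovector_smul`** (for an orthonormal basis `b`,
  `Σ_{v : Fin m → ι} φ(b ∘ v) (b ∘ v)^♭ = m! φ` — the expansion of an `m`-covector in the frame
  covectors, written as a sum over all multi-indices so that no ordering of multi-indices is
  needed), **`sum_frameVector_smul`** (the dual expansion `Σ_v τ((b∘v)^♭) (b∘v) = m! τ` of an
  `m`-vector), `frameVector_eq_zero_of_finrank_lt` (frames in a subspace of dimension `< m` have
  zero `m`-vector), `exists_orthonormalBasis_adapted` (an orthonormal basis whose first `dim W`
  vectors lie in `W` and the others in `Wᗮ`), `Multivector.factorial_smul_eq_sum_filter`.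
* **`Multivector.eq_zero_of_forall_wedgeOne_eq_zero`**, **`Multivector.eq_smul_frameVector_of_forall_wedgeOne_eq_zero`**
  — the algebraic half of the lemma: if `τ(v^♭ ∧ ω) = 0` for all `v ∈ Wᗮ` and all
  `(m-1)`-covectors `ω` ("`τ ∈ ⋀_m W`"), then `τ = 0` when `dim W < m`, and `τ = τ(e^♭) e₁ ∧ ⋯ ∧ e_m`
  for any orthonormal frame `e` of `W` when `dim W = m`.
* **`Multivector.contractionVector`** `w_τ(ω)` (the vector with `⟪w_τ(ω), v⟫ = τ(v^♭ ∧ ω)`),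
  `Multivector.apply_wedgeOne_eq` (`τ(ℓ ∧ ω) = ℓ(w_τ(ω))`), **`Multivector.invariantSubspace`**
  `W_τ = {w_τ(ω) : ω}` and `apply_wedgeOne_eq_zero_of_mem_orthogonal` (`Wτᗮ` annihilates `τ`).
* **`integral_fderiv_contractionVector_eq_zero`** — the analytic half: if `∂(ν ∧ τ) = 0` then
  `∫ D g(x)(w_τ(ω)) dν(x) = 0` for every smooth compactly supported `g` (test the cycle on
  `g • ω`); **`map_add_eq_self_of_forall_integral_fderiv_eq_zero`** — a locally finite measure
  with `∫ D_w g dν = 0` for all test functions `g` is invariant under translation by `w`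
  (fundamental theorem of calculus along `t ↦ x + t w` and Fubini, then uniqueness of measures
  with equal integrals of test functions via Radon–Nikodym densities);
  **`map_add_eq_self_of_boundary_vectorCurrent_eq_zero`** — `ν` is `W_τ`-invariant.
* **`Multivector.le_finrank_invariantSubspace`** (`τ ≠ 0 ⟹ dim W_τ ≥ k + 1`) and
  **`Multivector.eq_smul_frameVector_of_finrank_invariantSubspace_eq`** (`dim W_τ = k + 1 ⟹ τ`
  is a multiple of `e₀ ∧ ⋯ ∧ e_k` for every orthonormal frame `e` of `W_τ`) — the forms used in
  the closure theorem, where the complementary bound `dim W_τ ≤ k + 1` comes from the lower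
  density bound of the blow-up measure (tube packing, in the sequel file on translation-invariant
  measures).

Definitions with bodies (`Multivector.contractionVector`, `Multivector.invariantSubspace`) and
theorems; no named facts.

## References

* B. White, *A new proof of the compactness theorem for integral currents*, Comment. Math.
  Helv. 64 (1989) 207–220, p. 213 [White1989].
* L. Bandara, *The closure theorem for integral currents without the structure theorem*,
  B.Sc. thesis, ANU 2006, Thm. 3.3.6, Lemma 4.1.9 (held copy
  `lit paper:galaxy-pdf-8023002039701172160`, PDF pp. 30–33, 41) [Bandara2006].
* H. Federer, *Geometric Measure Theory*, Springer 1969, 1.7.5, 4.1.7 [Federer1969].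
-/

noncomputable section

open scoped Distributions ENNReal NNReal Topology ContDiff RealInnerProductSpace Pointwise
open MeasureTheory TopologicalSpace Set Filter Metric Function

namespace Literature.Geometry.GeometricMeasureTheory

-- Nested operator-norm instances on (duals of) `E [⋀^Fin m]→L[ℝ] ℝ`, as in `Currents.lean`.
set_option maxSynthPendingDepth 3

/-! ### Frame calculus -/

section Frames

variable {V : Type*} [NormedAddCommGroup V] [InnerProductSpace ℝ V] {m : ℕ}

/-- Permuting a frame multiplies its dual covector by the sign of the permutation:
`(g ∘ σ)^♭ = sgn σ · g^♭` (rows of the Gram determinant are permuted). [cite: Federer1969, 1.7.5] -/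
theorem frameCovector_comp_perm (g : Fin m → V) (σ : Equiv.Perm (Fin m)) :
    frameCovector (g ∘ σ) = ((Equiv.Perm.sign σ : ℤ) : ℝ) • frameCovector g := by
  ext v
  rw [frameCovector_apply, ContinuousAlternatingMap.smul_apply, frameCovector_apply, smul_eq_mul]
  have : (Matrix.of fun i j => ⟪(g ∘ σ) j, v i⟫) =
      (Matrix.of fun i j => ⟪g j, v i⟫).submatrix id σ := by
    ext i j; rfl
  rw [this, Matrix.det_permute']

/-- An alternating form vanishes on a frame obtained from another by a permutation up to sign:
`φ (v ∘ σ) = sgn σ · φ v`. [cite: Federer1969, 1.4.1] -/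
theorem Covector.apply_comp_perm (φ : Covector V m) (v : Fin m → V) (σ : Equiv.Perm (Fin m)) :
    φ (v ∘ σ) = ((Equiv.Perm.sign σ : ℤ) : ℝ) • φ v := by
  have h := φ.toAlternatingMap.map_perm v σ
  rw [ContinuousAlternatingMap.coe_toAlternatingMap] at h
  rw [h, Units.smul_def, Int.cast_smul_eq_zsmul]

/-- **Laplace expansion**: `u^♭ ∧ (f₀^♭ ∧ ⋯ ∧ f_{k-1}^♭) = (u, f₀, …, f_{k-1})^♭`, i.e.
`wedgeOne (innerSL u) (frameCovector f) = frameCovector (Fin.cons u f)` (expansion of the Gram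
determinant along its first column). [cite: Federer1969, 1.7.5] -/
theorem wedgeOne_innerSL_frameCovector {k : ℕ} (u : V) (f : Fin k → V) :
    wedgeOne V k (innerSL ℝ u) (frameCovector f) = frameCovector (Fin.cons u f) := by
  ext v
  rw [wedgeOne_apply, ContinuousAlternatingMap.alternatizeUncurryFin_apply, frameCovector_apply,
    Matrix.det_succ_column_zero]
  refine Finset.sum_congr rfl fun i _ => ?_
  have h0 : Matrix.of (fun i j => ⟪(Fin.cons u f : Fin (k + 1) → V) j, v i⟫) i 0 = ⟪u, v i⟫ := by
    simp
  have h1 : (Matrix.of fun i j => ⟪(Fin.cons u f : Fin (k + 1) → V) j, v i⟫).submatrix i.succAbove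
      Fin.succ = Matrix.of fun a c => ⟪f c, i.removeNth v a⟫ := by
    ext a c; simp [Fin.removeNth]
  rw [h0, h1, ContinuousLinearMap.smulRight_apply, ContinuousAlternatingMap.smul_apply,
    frameCovector_apply, innerSL_apply_apply, smul_eq_mul, zsmul_eq_mul, Int.cast_pow, Int.cast_neg,
    Int.cast_one, mul_assoc]

/-- **Expansion of an `m`-covector in the frame covectors of an orthonormal basis**, summed over
ALL multi-indices: `Σ_{v : Fin m → ι} φ(b ∘ v) • (b ∘ v)^♭ = m! • φ` (each increasing multi-index
is hit `m!` times with the same term, non-injective ones contribute `0`).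
[cite: Federer1969, 1.7.5] -/
theorem sum_frameCovector_smul {ι : Type*} [Fintype ι] [DecidableEq ι] (b : OrthonormalBasis ι ℝ V)
    (φ : Covector V m) :
    ∑ v : Fin m → ι, φ (fun j => b (v j)) • frameCovector (fun j => b (v j)) =
      (m.factorial : ℝ) • φ := by
  apply ContinuousAlternatingMap.toAlternatingMap_injective
  apply Module.Basis.ext_alternating b.toBasis
  intro w hw
  simp only [ContinuousAlternatingMap.coe_toAlternatingMap, OrthonormalBasis.coe_toBasis,
    ContinuousAlternatingMap.sum_apply, ContinuousAlternatingMap.smul_apply, smul_eq_mul]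
  -- the Gram matrix of `b ∘ v` against `b ∘ w`
  have hgram : ∀ v : Fin m → ι, frameCovector (fun j => b (v j)) (fun i => b (w i)) =
      (Matrix.of fun i j => if v j = w i then (1 : ℝ) else 0).det := fun v => by
    rw [frameCovector_apply]
    congr 1; ext i j
    rw [Matrix.of_apply, Matrix.of_apply, orthonormal_iff_ite.1 b.orthonormal]
  -- the multi-indices `w ∘ σ`
  set S : Finset (Fin m → ι) := Finset.univ.image fun σ : Equiv.Perm (Fin m) => w ∘ σ with hS
  have hinjS : Injective fun σ : Equiv.Perm (Fin m) => w ∘ (σ : Fin m → Fin m) := by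
    intro σ σ' h
    ext j
    have := congr_fun h j
    exact congr_arg Fin.val (hw this)
  rw [← Finset.sum_subset (Finset.subset_univ S)]
  · rw [hS, Finset.sum_image fun σ _ σ' _ h => hinjS h]
    have hterm : ∀ σ : Equiv.Perm (Fin m),
        φ (fun j => b ((w ∘ σ) j)) * frameCovector (fun j => b ((w ∘ σ) j)) (fun i => b (w i)) =
          φ fun i => b (w i) := fun σ => by
      have h1 : (fun j => b ((w ∘ σ) j)) = (fun i => b (w i)) ∘ σ := rfl
      have hon : Orthonormal ℝ (fun i => b (w i)) := b.orthonormal.comp _ hw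
      have hs : ((Equiv.Perm.sign σ : ℤ) : ℝ) * ((Equiv.Perm.sign σ : ℤ) : ℝ) = 1 := by
        rw [← Int.cast_mul, ← Units.val_mul, Int.units_mul_self, Units.val_one, Int.cast_one]
      rw [h1, Covector.apply_comp_perm, frameCovector_comp_perm, ContinuousAlternatingMap.smul_apply,
        frameCovector_self hon, smul_eq_mul, smul_eq_mul, mul_one]
      calc _ = ((Equiv.Perm.sign σ : ℤ) : ℝ) * ((Equiv.Perm.sign σ : ℤ) : ℝ) * φ (fun i => b (w i)) := by
            ring
        _ = _ := by rw [hs, one_mul]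
    simp_rw [hterm, Finset.sum_const, Finset.card_univ, Fintype.card_perm, Fintype.card_fin,
      nsmul_eq_mul]
  · intro v _ hv
    rw [hgram]
    -- some `w i` is missed by `v`, so row `i` of the Gram matrix vanishes
    by_cases hmiss : ∃ i, ∀ j, v j ≠ w i
    · obtain ⟨i, hi⟩ := hmiss
      rw [Matrix.det_eq_zero_of_row_eq_zero i fun j => by simp [hi j], mul_zero]
    · exfalso
      push Not at hmiss
      choose σ' hσ' using hmiss
      have hσ'inj : Injective σ' := fun i i' h => hw (by rw [← hσ' i, ← hσ' i', h])
      have hσ'bij : Bijective σ' := Finite.injective_iff_bijective.1 hσ'inj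
      refine hv ?_
      rw [hS, Finset.mem_image]
      refine ⟨(Equiv.ofBijective σ' hσ'bij).symm, Finset.mem_univ _, ?_⟩
      funext j
      obtain ⟨i, rfl⟩ := hσ'bij.2 j
      simp [hσ' i]

/-- **Expansion of an `m`-vector in the simple `m`-vectors of an orthonormal basis**:
`Σ_{v : Fin m → ι} τ((b ∘ v)^♭) • (b ∘ v) = m! • τ`. [cite: Federer1969, 1.7.5] -/
theorem sum_frameVector_smul {ι : Type*} [Fintype ι] [DecidableEq ι] (b : OrthonormalBasis ι ℝ V)
    (τ : Multivector V m) :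
    ∑ v : Fin m → ι, τ (frameCovector fun j => b (v j)) • frameVector (fun j => b (v j)) =
      (m.factorial : ℝ) • τ := by
  ext φ
  have h := congr_arg τ (sum_frameCovector_smul b φ)
  rw [map_sum, map_smul] at h
  simp only [_root_.sum_apply, _root_.smul_apply, frameVector_apply, smul_eq_mul] at h ⊢
  rw [← h]
  exact Finset.sum_congr rfl fun v _ => by rw [map_smul, smul_eq_mul, mul_comm]

/-- Frames in a subspace of dimension `< m` have zero simple `m`-vector (`⋀_m W = 0` for
`m > dim W`). [cite: Federer1969, 1.3.2] -/
theorem frameVector_eq_zero_of_finrank_lt {W : Submodule ℝ V} [FiniteDimensional ℝ W]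
    (hW : Module.finrank ℝ W < m) {u : Fin m → V} (hu : ∀ j, u j ∈ W) : frameVector u = 0 := by
  ext φ
  rw [frameVector_apply, _root_.zero_apply]
  set u' : Fin m → W := fun j => ⟨u j, hu j⟩ with hu'
  have hdep : ¬ LinearIndependent ℝ u' := fun h => by
    have := h.fintype_card_le_finrank
    rw [Fintype.card_fin] at this
    omega
  have hdep' : ¬ LinearIndependent ℝ u := by
    intro h
    apply hdep
    have : u = W.subtype ∘ u' := rfl
    rw [this] at h
    exact LinearIndependent.of_comp _ h
  have := φ.toAlternatingMap.map_linearDependent u hdep'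
  rwa [ContinuousAlternatingMap.coe_toAlternatingMap] at this

/-- **An orthonormal basis adapted to a subspace**: the first `dim W` vectors lie in `W`, the
others in `Wᗮ` (the coordinates "`P` parallel to `ℝⁿ × {0}`" of the source).
[cite: Bandara2006, Thm. 3.3.6; Federer1969, 1.7.4] -/
theorem exists_orthonormalBasis_adapted [FiniteDimensional ℝ V] (W : Submodule ℝ V) :
    ∃ b : OrthonormalBasis (Fin (Module.finrank ℝ V)) ℝ V, ∀ i : Fin (Module.finrank ℝ V),
      ((i : ℕ) < Module.finrank ℝ W → b i ∈ W) ∧ (Module.finrank ℝ W ≤ (i : ℕ) → b i ∈ Wᗮ) := by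
  set d := Module.finrank ℝ W with hd
  set eW := stdOrthonormalBasis ℝ W with heW
  set v : Fin (Module.finrank ℝ V) → V := fun i => if h : (i : ℕ) < d then (eW ⟨i, h⟩ : V) else 0
    with hv
  set s : Set (Fin (Module.finrank ℝ V)) := {i | (i : ℕ) < d} with hs
  have hvs : s.restrict v = (W.subtypeₗᵢ ∘ eW) ∘
      fun i : s => (⟨((i.1 : Fin (Module.finrank ℝ V)) : ℕ), i.2⟩ : Fin d) := by
    funext i
    obtain ⟨i, hi⟩ := i
    simp only [restrict_apply, comp_apply, hv]
    rw [dif_pos (by exact hi)]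
    rfl
  have hon : Orthonormal ℝ (s.restrict v) := by
    rw [hvs]
    refine (eW.orthonormal.comp_linearIsometry _).comp _ fun i i' h => ?_
    exact Subtype.ext (Fin.ext (by simpa using congr_arg Fin.val h))
  obtain ⟨b, hb⟩ := Orthonormal.exists_orthonormalBasis_extension_of_card_eq
    (Fintype.card_fin _).symm hon
  have hbW : ∀ i : Fin (Module.finrank ℝ V), ∀ h : (i : ℕ) < d, b i = (eW ⟨i, h⟩ : V) := fun i h => by
    rw [hb i h, hv]; exact dif_pos h
  refine ⟨b, fun i => ⟨fun hi => ?_, fun hi => ?_⟩⟩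
  · rw [hbW i hi]; exact (eW ⟨i, hi⟩).2
  · rw [Submodule.mem_orthogonal]
    intro u hu
    have hdn : d ≤ Module.finrank ℝ V := W.finrank_le
    have hrepr : u = ∑ j : Fin d, eW.repr ⟨u, hu⟩ j • (eW j : V) := by
      have h1 := congr_arg (fun x : W => (x : V)) (eW.sum_repr ⟨u, hu⟩)
      simp only [Submodule.coe_sum, Submodule.coe_smul] at h1
      exact h1.symm
    rw [hrepr, sum_inner]
    refine Finset.sum_eq_zero fun j _ => ?_
    have hj : ((Fin.castLE hdn j : Fin _) : ℕ) < d := by simp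
    have hne : Fin.castLE hdn j ≠ i := by
      intro h
      have := congr_arg Fin.val h
      simp at this
      omega
    have hbj : b (Fin.castLE hdn j) = (eW j : V) := by
      rw [hbW (Fin.castLE hdn j) hj]
      congr 2
    rw [real_inner_smul_left, ← hbj, orthonormal_iff_ite.1 b.orthonormal, if_neg hne, mul_zero]

/-- The core of the algebraic half of the constant vectorfield lemma, in a basis: if the
contractions of `τ` with the basis vectors outside `p` vanish, the frame expansion of
`(k+1)! • τ` only involves multi-indices inside `p`. [cite: Bandara2006, Thm. 3.3.6] -/
theorem Multivector.factorial_smul_eq_sum_filter {ι : Type*} [Fintype ι] [DecidableEq ι]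
    (b : OrthonormalBasis ι ℝ V) (p : ι → Prop) [DecidablePred p] {k : ℕ} (τ : Multivector V (k + 1))
    (hbad : ∀ i, ¬ p i → ∀ η : Covector V k, τ (wedgeOne V k (innerSL ℝ (b i)) η) = 0) :
    ((k + 1).factorial : ℝ) • τ =
      ∑ v ∈ Finset.univ.filter (fun v : Fin (k + 1) → ι => ∀ j, p (v j)),
        τ (frameCovector fun j => b (v j)) • frameVector (fun j => b (v j)) := by
  rw [← sum_frameVector_smul b τ]
  symm
  refine Finset.sum_subset (Finset.filter_subset _ _) fun v _ hv => ?_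
  rw [Finset.mem_filter, not_and] at hv
  obtain ⟨j₀, hj₀⟩ := not_forall.1 (hv (Finset.mem_univ v))
  set g : Fin (k + 1) → V := fun j => b (v j) with hg
  set σ : Equiv.Perm (Fin (k + 1)) := Equiv.swap 0 j₀ with hσ
  have hgg : g = (g ∘ σ) ∘ σ := by
    funext j; simp [hσ, Equiv.swap_apply_self]
  have hcons : g ∘ σ = Fin.cons (b (v j₀)) (Fin.tail (g ∘ σ)) := by
    rw [← Fin.cons_self_tail (g ∘ σ)]
    congr 1
  have h0 : τ (frameCovector g) = 0 := by
    rw [hgg, frameCovector_comp_perm, map_smul, hcons, ← wedgeOne_innerSL_frameCovector,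
      hbad (v j₀) hj₀, smul_zero]
  rw [h0, zero_smul]

/-- **Algebraic half of the constant vectorfield lemma, small invariant space**: if
`τ(u^♭ ∧ ω) = 0` for all `u ∈ Wᗮ` and all `k`-covectors `ω`, and `dim W < k + 1`, then `τ = 0`
(Bandara: "`τ ∈ ⋀ₙ V`", and `⋀_{k+1} W = 0`). [cite: Bandara2006, Thm. 3.3.6] -/
theorem Multivector.eq_zero_of_forall_wedgeOne_eq_zero [FiniteDimensional ℝ V] {k : ℕ}
    (τ : Multivector V (k + 1)) (W : Submodule ℝ V)
    (hann : ∀ u ∈ Wᗮ, ∀ η : Covector V k, τ (wedgeOne V k (innerSL ℝ u) η) = 0)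
    (hW : Module.finrank ℝ W < k + 1) : τ = 0 := by
  obtain ⟨b, hb⟩ := exists_orthonormalBasis_adapted W
  have h := Multivector.factorial_smul_eq_sum_filter b (fun i => (i : ℕ) < Module.finrank ℝ W) τ
    fun i hi η => hann (b i) ((hb i).2 (not_lt.1 hi)) η
  have hzero : ∀ v ∈ Finset.univ.filter
      (fun v : Fin (k + 1) → Fin (Module.finrank ℝ V) => ∀ j, ((v j : Fin _) : ℕ) < Module.finrank ℝ W),
      τ (frameCovector fun j => b (v j)) • frameVector (fun j => b (v j)) = 0 := by
    intro v hv
    rw [Finset.mem_filter] at hv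
    rw [frameVector_eq_zero_of_finrank_lt hW fun j => (hb (v j)).1 (hv.2 j), smul_zero]
  rw [Finset.sum_eq_zero hzero, smul_eq_zero] at h
  exact h.resolve_left (Nat.cast_ne_zero.2 (Nat.factorial_ne_zero _))

/-- **Algebraic half of the constant vectorfield lemma, critical dimension**: if
`τ(u^♭ ∧ ω) = 0` for all `u ∈ Wᗮ` and all `k`-covectors `ω`, and `dim W = k + 1`, then for every
orthonormal frame `e` of `W`, `τ = τ(e^♭) • e₀ ∧ ⋯ ∧ e_k` — `τ` is SIMPLE.
[cite: Bandara2006, Thm. 3.3.6; White1989, p. 213] -/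
theorem Multivector.eq_smul_frameVector_of_forall_wedgeOne_eq_zero [FiniteDimensional ℝ V] {k : ℕ}
    (τ : Multivector V (k + 1)) (W : Submodule ℝ V)
    (hann : ∀ u ∈ Wᗮ, ∀ η : Covector V k, τ (wedgeOne V k (innerSL ℝ u) η) = 0)
    (hW : Module.finrank ℝ W = k + 1) {e : Fin (k + 1) → V} (he : Orthonormal ℝ e)
    (heW : ∀ j, e j ∈ W) : τ = τ (frameCovector e) • frameVector e := by
  obtain ⟨b, hb⟩ := exists_orthonormalBasis_adapted W
  have h := Multivector.factorial_smul_eq_sum_filter b (fun i => (i : ℕ) < Module.finrank ℝ W) τ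
    fun i hi η => hann (b i) ((hb i).2 (not_lt.1 hi)) η
  have hspan : Submodule.span ℝ (Set.range e) = W := by
    refine Submodule.eq_of_le_of_finrank_eq (Submodule.span_le.2 (Set.range_subset_iff.2 heW)) ?_
    rw [finrank_span_eq_card he.linearIndependent, Fintype.card_fin, hW]
  have hterm : ∀ v ∈ Finset.univ.filter
      (fun v : Fin (k + 1) → Fin (Module.finrank ℝ V) => ∀ j, ((v j : Fin _) : ℕ) < Module.finrank ℝ W),
      τ (frameCovector fun j => b (v j)) • frameVector (fun j => b (v j)) =
        (τ (frameCovector fun j => b (v j)) *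
          (Matrix.of fun i j => ⟪e i, b (v j)⟫).det) • frameVector e := by
    intro v hv
    rw [Finset.mem_filter] at hv
    have hw : ∀ j, b (v j) ∈ Submodule.span ℝ (Set.range e) := fun j => by
      rw [hspan]; exact (hb (v j)).1 (hv.2 j)
    rw [frameVector_eq_det_smul_of_mem_span he hw, smul_smul]
  rw [Finset.sum_congr rfl hterm, ← Finset.sum_smul] at h
  set c := ∑ v ∈ Finset.univ.filter
      (fun v : Fin (k + 1) → Fin (Module.finrank ℝ V) => ∀ j, ((v j : Fin _) : ℕ) < Module.finrank ℝ W),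
      τ (frameCovector fun j => b (v j)) * (Matrix.of fun i j => ⟪e i, b (v j)⟫).det with hc
  have hfac : ((k + 1).factorial : ℝ) ≠ 0 := Nat.cast_ne_zero.2 (Nat.factorial_ne_zero _)
  have hτ : τ = (((k + 1).factorial : ℝ)⁻¹ * c) • frameVector e := by
    rw [mul_smul, ← h, smul_smul, inv_mul_cancel₀ hfac, one_smul]
  have hcoef : τ (frameCovector e) = ((k + 1).factorial : ℝ)⁻¹ * c := by
    rw [hτ, _root_.smul_apply, frameVector_apply, frameCovector_self he, smul_eq_mul, mul_one]
  rw [hcoef, ← hτ]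

end Frames

/-! ### The contraction vectors `w_τ(η)` and the invariant subspace `W_τ` -/

section Contraction

variable {V : Type*} [NormedAddCommGroup V] [InnerProductSpace ℝ V] [CompleteSpace V] {k : ℕ}

/-- **The contraction vector** `w_τ(η) ∈ V` of a `(k+1)`-vector `τ` against a `k`-covector `η`:
the Riesz representative of `v ↦ τ(v^♭ ∧ η)`, so that `⟪w_τ(η), v⟫ = τ(v^♭ ∧ η)` (the interior
product `τ ⌞ η`, identified with a vector). [cite: Bandara2006, Thm. 3.3.6; Federer1969, 1.5.1] -/
def Multivector.contractionVector (τ : Multivector V (k + 1)) (η : Covector V k) : V :=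
  (InnerProductSpace.toDual ℝ V).symm (τ.comp (((wedgeOne V k).flip η).comp (innerSL ℝ)))

/-- `⟪w_τ(η), v⟫ = τ(v^♭ ∧ η)`. [cite: Bandara2006, Thm. 3.3.6] -/
theorem Multivector.inner_contractionVector (τ : Multivector V (k + 1)) (η : Covector V k) (v : V) :
    ⟪τ.contractionVector η, v⟫ = τ (wedgeOne V k (innerSL ℝ v) η) := by
  rw [Multivector.contractionVector, InnerProductSpace.toDual_symm_apply]
  rfl

/-- `τ(ℓ ∧ η) = ℓ(w_τ(η))` for every continuous linear functional `ℓ`.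
[cite: Bandara2006, Thm. 3.3.6] -/
theorem Multivector.apply_wedgeOne_eq (τ : Multivector V (k + 1)) (ℓ : V →L[ℝ] ℝ)
    (η : Covector V k) : τ (wedgeOne V k ℓ η) = ℓ (τ.contractionVector η) := by
  obtain ⟨u, rfl⟩ := (InnerProductSpace.toDual ℝ V).surjective ℓ
  have hu : ((InnerProductSpace.toDual ℝ V) u : V →L[ℝ] ℝ) = innerSL ℝ u := by
    ext v; rfl
  rw [hu, ← Multivector.inner_contractionVector, innerSL_apply_apply, real_inner_comm]

/-- `w_τ(t η) = t w_τ(η)`. [cite: Bandara2006, Thm. 3.3.6] -/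
theorem Multivector.contractionVector_smul (τ : Multivector V (k + 1)) (t : ℝ) (η : Covector V k) :
    τ.contractionVector (t • η) = t • τ.contractionVector η := by
  refine ext_inner_right ℝ fun v => ?_
  rw [Multivector.inner_contractionVector, map_smul, map_smul, real_inner_smul_left,
    Multivector.inner_contractionVector, smul_eq_mul]

/-- **The invariant subspace** `W_τ = span {w_τ(η) : η}` of a `(k+1)`-vector (White's "space of
vectors such that `μ ∧ τ` is translation invariant"). [cite: Bandara2006, Lemma 4.1.9] -/
def Multivector.invariantSubspace (τ : Multivector V (k + 1)) : Submodule ℝ V :=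
  Submodule.span ℝ (Set.range τ.contractionVector)

/-- `w_τ(η) ∈ W_τ`. [cite: Bandara2006, Lemma 4.1.9] -/
theorem Multivector.contractionVector_mem (τ : Multivector V (k + 1)) (η : Covector V k) :
    τ.contractionVector η ∈ τ.invariantSubspace :=
  Submodule.subset_span ⟨η, rfl⟩

/-- **`W_τᗮ` annihilates `τ`**: `τ(u^♭ ∧ η) = 0` for `u ∈ W_τᗮ` and every `k`-covector `η`.
[cite: Bandara2006, Thm. 3.3.6] -/
theorem Multivector.apply_wedgeOne_eq_zero_of_mem_orthogonal (τ : Multivector V (k + 1)) {u : V}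
    (hu : u ∈ τ.invariantSubspaceᗮ) (η : Covector V k) :
    τ (wedgeOne V k (innerSL ℝ u) η) = 0 := by
  rw [← Multivector.inner_contractionVector]
  exact Submodule.inner_right_of_mem_orthogonal (τ.contractionVector_mem η) hu

end Contraction

/-! ### Translation invariance from `∂(ν ∧ τ) = 0` -/

section Invariance

variable {V : Type*} [NormedAddCommGroup V] [InnerProductSpace ℝ V] [FiniteDimensional ℝ V]
  [MeasurableSpace V] [BorelSpace V] {k : ℕ}

/-- **Testing the cycle `ν ∧ τ` on `g • η`**: if `∂(ν ∧ τ) = 0` for a locally finite measure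
`ν` and a constant `(k+1)`-vector `τ`, then `∫ Dg(x)(w_τ(η)) dν(x) = 0` for every test function
`g` and every constant `k`-covector `η` (since `d(g η) = Dg ∧ η` and `τ(Dg ∧ η) = Dg(w_τ(η))`).
[cite: Bandara2006, Thm. 3.3.6; White1989, p. 213] -/
theorem integral_fderiv_contractionVector_eq_zero {ν : Measure V} [IsLocallyFiniteMeasure ν]
    (τ : Multivector V (k + 1))
    (hC : (vectorCurrent ν (fun _ => τ) : Current (⊤ : Opens V) (k + 1)).boundary = 0)
    (η : Covector V k) (g : 𝓓((⊤ : Opens V), ℝ)) :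
    ∫ x, fderiv ℝ (g : V → ℝ) x (τ.contractionVector η) ∂ν = 0 := by
  have hli : LocallyIntegrableOn (fun _ : V => τ) ((⊤ : Opens V) : Set V) ν :=
    (locallyIntegrable_const τ).locallyIntegrableOn _
  have h := DFunLike.congr_fun hC (smulCovectorCLM η g)
  rw [Current.boundary_apply, vectorCurrent_apply hli, _root_.zero_apply] at h
  rw [← h]
  refine integral_congr_ae (Eventually.of_forall fun x => ?_)
  change _ = τ (TestForm.extDerivCLM (smulCovectorCLM η g) x)
  rw [extDerivCLM_smulCovectorCLM_apply, ← wedgeOne_apply, Multivector.apply_wedgeOne_eq]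

/-- **Zero derivative along `w` makes `∫ g(x + t w) dν(x)` constant in `t`**: if
`∫ Dg(x)(w) dν(x) = 0` for all test functions `g`, then `∫ g(x + t w) dν = ∫ g dν`
(differentiate under the integral; the derivative is the hypothesis applied to the translate
`g(· + t w)`). [cite: Bandara2006, Thm. 3.3.6] -/
theorem integral_comp_add_smul_eq_of_forall_integral_fderiv_eq_zero {ν : Measure V}
    [IsLocallyFiniteMeasure ν] {w : V}
    (h : ∀ g : 𝓓((⊤ : Opens V), ℝ), ∫ x, fderiv ℝ (g : V → ℝ) x w ∂ν = 0)
    (g : 𝓓((⊤ : Opens V), ℝ)) (t : ℝ) : ∫ x, g (x + t • w) ∂ν = ∫ x, g x ∂ν := by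
  -- translates of test functions are test functions
  have htrans : ∀ s : ℝ, ∃ ψ : 𝓓((⊤ : Opens V), ℝ), ∀ x, ψ x = g (x + s • w) := by
    intro s
    obtain ⟨ψ, hψ⟩ := exists_testFunction_comp_add_smul (Ω₁ := (⊤ : Opens V)) (Ω₂ := (⊤ : Opens V))
      (-(s • w)) one_ne_zero (by simp) g
    exact ⟨ψ, fun x => by rw [hψ x, inv_one, one_smul, sub_neg_eq_add]⟩
  set K : Set V := tsupport (g : V → ℝ) with hK
  have hKc : IsCompact K := g.hasCompactSupport
  obtain ⟨M, hM⟩ := (g.hasCompactSupport.fderiv (𝕜 := ℝ)).exists_bound_of_continuous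
    (g.contDiff.continuous_fderiv (by simp))
  have hM0 : 0 ≤ M := (norm_nonneg _).trans (hM 0)
  have hdiff : Differentiable ℝ (g : V → ℝ) := g.contDiff.differentiable (by simp)
  -- the parametric integral `F(t) = ∫ g(x + t w) dν` has derivative `0` everywhere
  set F : ℝ → ℝ := fun s => ∫ x, g (x + s • w) ∂ν with hF
  have hderiv : ∀ t₀ : ℝ, HasDerivAt F 0 t₀ := by
    intro t₀
    set K' : Set V := K + closedBall (0 : V) ((|t₀| + 1) * ‖w‖) with hK'
    have hK'c : IsCompact K' := hKc.add (isCompact_closedBall _ _)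
    have hcont : ∀ s : ℝ, Continuous fun x : V => g (x + s • w) := fun s =>
      g.continuous.comp (continuous_id.add continuous_const)
    have hcont' : ∀ s : ℝ, Continuous fun x : V => fderiv ℝ (g : V → ℝ) (x + s • w) w := fun s =>
      ((g.contDiff.continuous_fderiv (by simp)).comp (continuous_id.add continuous_const)).clm_apply
        continuous_const
    have hzero : ∀ s ∈ ball t₀ 1, ∀ x ∉ K', fderiv ℝ (g : V → ℝ) (x + s • w) w = 0 := by
      intro s hs x hx
      have hxs : x + s • w ∉ K := by
        intro hmem
        refine hx ⟨x + s • w, hmem, -(s • w), ?_, by abel⟩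
        rw [mem_closedBall, dist_zero_right, norm_neg, norm_smul, Real.norm_eq_abs]
        refine mul_le_mul_of_nonneg_right ?_ (norm_nonneg _)
        rw [mem_ball, Real.dist_eq] at hs
        have := abs_sub_abs_le_abs_sub s t₀
        linarith
      have : fderiv ℝ (g : V → ℝ) (x + s • w) = 0 := by
        by_contra hne
        exact hxs (tsupport_fderiv_subset ℝ (subset_tsupport _ hne))
      simp [this]
    have hmain := hasDerivAt_integral_of_dominated_loc_of_deriv_le (μ := ν) (x₀ := t₀)
      (F := fun s x => g (x + s • w)) (F' := fun s x => fderiv ℝ (g : V → ℝ) (x + s • w) w)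
      (bound := K'.indicator fun _ => M * ‖w‖) (ball_mem_nhds t₀ zero_lt_one)
      (Eventually.of_forall fun s => (hcont s).aestronglyMeasurable)
      ((hcont t₀).integrable_of_hasCompactSupport
        (g.hasCompactSupport.comp_homeomorph (Homeomorph.addRight (t₀ • w))))
      (hcont' t₀).aestronglyMeasurable
      (Eventually.of_forall fun x s hs => by
        by_cases hx : x ∈ K'
        · rw [indicator_of_mem hx]
          exact (ContinuousLinearMap.le_opNorm _ _).trans
            (mul_le_mul_of_nonneg_right (hM _) (norm_nonneg _))
        · rw [indicator_of_notMem hx, hzero s hs x hx, norm_zero])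
      ((integrable_indicator_iff hK'c.measurableSet).2
        ((integrableOn_const_iff).2 (Or.inr hK'c.measure_lt_top)))
      (Eventually.of_forall fun x s _ => by
        have h1 : HasDerivAt (fun s : ℝ => x + s • w) w s := by
          simpa using ((hasDerivAt_id s).smul_const w).const_add x
        exact (hdiff (x + s • w)).hasFDerivAt.comp_hasDerivAt s h1)
    have hint0 : ∫ x, fderiv ℝ (g : V → ℝ) (x + t₀ • w) w ∂ν = 0 := by
      obtain ⟨ψ, hψ⟩ := htrans t₀
      have hψ' : (ψ : V → ℝ) = fun x => g (x + t₀ • w) := funext hψ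
      have := h ψ
      simp_rw [hψ', fderiv_comp_add_right] at this
      exact this
    rw [hint0] at hmain
    exact hmain.2
  have hconst := is_const_of_deriv_eq_zero (fun t₀ => (hderiv t₀).differentiableAt)
    (fun t₀ => (hderiv t₀).deriv) t 0
  simp only [hF, zero_smul, add_zero] at hconst
  exact hconst

/-- **Two locally finite measures with the same integrals of test functions are equal**
(Radon–Nikodym densities with respect to `μ₁ + μ₂` and
`ae_eq_of_integral_contDiff_smul_eq`): a Radon measure, as a `0`-current, is determined by its
values on `𝒟⁰`. [cite: Federer1969, 4.1.5] -/
theorem Measure.eq_of_forall_integral_testFunction_eq {μ₁ μ₂ : Measure V}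
    [IsLocallyFiniteMeasure μ₁] [IsLocallyFiniteMeasure μ₂]
    (h : ∀ g : 𝓓((⊤ : Opens V), ℝ), ∫ x, g x ∂μ₁ = ∫ x, g x ∂μ₂) : μ₁ = μ₂ := by
  set μ := μ₁ + μ₂ with hμ
  have h1 : μ₁ ≪ μ := Measure.absolutelyContinuous_of_le (Measure.le_add_right le_rfl)
  have h2 : μ₂ ≪ μ := Measure.absolutelyContinuous_of_le (Measure.le_add_left le_rfl)
  have hli : ∀ {ρ : Measure V} [IsLocallyFiniteMeasure ρ], ρ ≪ μ →
      LocallyIntegrable (fun x => (ρ.rnDeriv μ x).toReal) μ := by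
    intro ρ _ hρ
    refine locallyIntegrable_iff.2 fun K hK => ⟨?_, ?_⟩
    · exact (Measure.measurable_rnDeriv ρ μ).ennreal_toReal.aestronglyMeasurable
    · refine lt_of_le_of_lt ?_ (hK.measure_lt_top (μ := ρ))
      refine le_trans (lintegral_mono fun x => ?_) (Measure.setLIntegral_rnDeriv_le K)
      rw [Real.enorm_eq_ofReal ENNReal.toReal_nonneg]
      exact ENNReal.ofReal_toReal_le
  have hae := ae_eq_of_integral_contDiff_smul_eq (hli h1) (hli h2) fun g hg hgs => by
    have hψ := h ⟨g, hg, hgs, by simp⟩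
    simp only [smul_eq_mul]
    simp_rw [mul_comm (g _)]
    rw [integral_toReal_rnDeriv_mul h1, integral_toReal_rnDeriv_mul h2]
    exact hψ
  have hae' : μ₁.rnDeriv μ =ᵐ[μ] μ₂.rnDeriv μ := by
    filter_upwards [hae, Measure.rnDeriv_lt_top μ₁ μ, Measure.rnDeriv_lt_top μ₂ μ] with x hx h1x h2x
    exact (ENNReal.toReal_eq_toReal_iff' h1x.ne h2x.ne).1 hx
  rw [← Measure.withDensity_rnDeriv_eq _ _ h1, ← Measure.withDensity_rnDeriv_eq _ _ h2]
  exact withDensity_congr_ae hae'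

/-- **Invariance under translation by `w` from `∫ D_w g dν = 0`**: a locally finite measure `ν`
on a finite-dimensional space with `∫ Dg(x)(w) dν(x) = 0` for all test functions `g` satisfies
`(· + w)_# ν = ν`. [cite: Bandara2006, Thm. 3.3.6] -/
theorem map_add_eq_self_of_forall_integral_fderiv_eq_zero {ν : Measure V} [IsLocallyFiniteMeasure ν]
    {w : V} (h : ∀ g : 𝓓((⊤ : Opens V), ℝ), ∫ x, fderiv ℝ (g : V → ℝ) x w ∂ν = 0) :
    ν.map (· + w) = ν := by
  have hmeas : Measurable fun x : V => x + w := measurable_add_const w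
  haveI : IsLocallyFiniteMeasure (ν.map (· + w)) := by
    refine ⟨fun x => ⟨ball x 1, ball_mem_nhds x one_pos, ?_⟩⟩
    rw [Measure.map_apply hmeas measurableSet_ball]
    have : (fun y : V => y + w) ⁻¹' ball x 1 = ball (x - w) 1 := by
      ext y; simp [mem_ball, dist_eq_norm]
    rw [this]
    exact measure_ball_lt_top
  refine Measure.eq_of_forall_integral_testFunction_eq fun g => ?_
  rw [integral_map hmeas.aemeasurable g.continuous.aestronglyMeasurable]
  have := integral_comp_add_smul_eq_of_forall_integral_fderiv_eq_zero h g 1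
  rwa [one_smul] at this

/-- **White's constant vectorfield lemma, invariance** [White1989, p. 213; Bandara2006,
Thm. 3.3.6 / Lemma 4.1.9]: if `ν` is a locally finite measure, `τ` a constant `(k+1)`-vector and
the current `ν ∧ τ` is a cycle, then `ν` is invariant under translation by every vector of the
invariant subspace `W_τ` (and `W_τᗮ` annihilates `τ`,
`Multivector.apply_wedgeOne_eq_zero_of_mem_orthogonal`). [cite: White1989, p. 213] -/
theorem map_add_eq_self_of_boundary_vectorCurrent_eq_zero {ν : Measure V} [IsLocallyFiniteMeasure ν]
    (τ : Multivector V (k + 1))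
    (hC : (vectorCurrent ν (fun _ => τ) : Current (⊤ : Opens V) (k + 1)).boundary = 0)
    {w : V} (hw : w ∈ τ.invariantSubspace) : ν.map (· + w) = ν := by
  suffices hall : ∀ t : ℝ, ν.map (· + t • w) = ν by simpa using hall 1
  induction hw using Submodule.span_induction with
  | mem x hx =>
    intro t
    obtain ⟨η, rfl⟩ := hx
    rw [← Multivector.contractionVector_smul]
    exact map_add_eq_self_of_forall_integral_fderiv_eq_zero
      (integral_fderiv_contractionVector_eq_zero τ hC (t • η))
  | zero => intro t; simp
  | add x y _ _ hx hy =>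
    intro t
    have hcomp : (fun z : V => z + t • (x + y)) = (fun z : V => z + t • y) ∘ fun z : V => z + t • x := by
      funext z; simp only [comp_apply, smul_add]; abel
    rw [hcomp, ← Measure.map_map (measurable_add_const _) (measurable_add_const _), hx t, hy t]
  | smul a x _ hx =>
    intro t
    rw [smul_smul]
    exact hx (t * a)

end Invariance

/-! ### The lemma as used in the closure theorem -/

section Structure

variable {V : Type*} [NormedAddCommGroup V] [InnerProductSpace ℝ V] [FiniteDimensional ℝ V] {k : ℕ}

/-- **A non-zero `(k+1)`-vector has invariant subspace of dimension `≥ k + 1`** (White: "τ(a) is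
a simple n-vector and dim(V) = n" — the lower bound). [cite: Bandara2006, Lemma 4.1.9] -/
theorem Multivector.le_finrank_invariantSubspace (τ : Multivector V (k + 1)) (hτ : τ ≠ 0) :
    k + 1 ≤ Module.finrank ℝ τ.invariantSubspace := by
  by_contra hlt
  exact hτ (τ.eq_zero_of_forall_wedgeOne_eq_zero τ.invariantSubspace
    (fun u hu η => τ.apply_wedgeOne_eq_zero_of_mem_orthogonal hu η) (not_le.1 hlt))

/-- **In the critical dimension `τ` is simple**: if `dim W_τ = k + 1` then
`τ = τ(e^♭) • e₀ ∧ ⋯ ∧ e_k` for every orthonormal frame `e` of `W_τ`; in particular `τ` "determines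
the `(k+1)`-plane `W_τ`". [cite: Bandara2006, Lemma 4.1.9; White1989, p. 213] -/
theorem Multivector.eq_smul_frameVector_of_finrank_invariantSubspace_eq (τ : Multivector V (k + 1))
    (hdim : Module.finrank ℝ τ.invariantSubspace = k + 1) {e : Fin (k + 1) → V}
    (he : Orthonormal ℝ e) (heW : ∀ j, e j ∈ τ.invariantSubspace) :
    τ = τ (frameCovector e) • frameVector e :=
  τ.eq_smul_frameVector_of_forall_wedgeOne_eq_zero τ.invariantSubspace
    (fun _ hu η => τ.apply_wedgeOne_eq_zero_of_mem_orthogonal hu η) hdim he heW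

end Structure

end Literature.Geometry.GeometricMeasureTheory
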